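import Summits.CriticalPhenomena.PercolationContinuityZ3.Theorems.PercNearOneGluingNoHeavyLowerTailFKAnalogues
import Literature.Probability.Percolation.TwoSetConditionalAssociationRC
import Literature.Probability.LatticeModels.RandomClusterEdgeWeightsConditioning
import Literature.Probability.Percolation.KozmaNitzanPreFKG
import HarnessLib

/-!
# FK sub-lane: hp-7's "coefficient monotonicity" (Lemma 2 of the hull-port induction) for the random-cluster measure, every `q ≥ 1`

Support file (`--supports stmt-CriticalPhenomena-4575`), FK sub-lane `prim-bschramm-fk-2` (gen 2); builds on p205010 (kernel theorem,
internal audit signed; external expert review pending).  No named facts, no sorries, no definitions; standard axioms.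

The one-edge Bernstein step of prim-hp-7's proof of `T_A ≥ 0` (⇒ MDL(X), the level-0 input of CSH; memo HP7-MDLX-PROOF.md §2–§3) needs,
for the deformed edge `e = xv` at the owner `x`, LEMMA 2 ("coefficient monotonicity"): `r¹ ≤ r⁰`, where `r^i = μ^i(z ∈ C_y | C_y ∌ s, x)` in the
graph with `e` contracted (`i = 1`) resp. deleted (`i = 0`).  At `q = 1` this is vdBHK's avoidance monotonicity.  For `φ_{w,q}`, `q ≥ 1`, the two
states are the conditional measures given `e` open / closed, which differ on the other edges; bschramm/FK-Q2.md §11.3 proves the FK version on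
paper.  THIS FILE proves it in the tree, in cross-multiplied (denominator-free) form under ONE measure `φ = rcMeasureW w q ∅`:
  `φ(E₂ ∩ {z∈C_y} ∩ {e open}) · φ(E₂ ∩ {e closed}) ≤ φ(E₂ ∩ {z∈C_y} ∩ {e closed}) · φ(E₂ ∩ {e open})`,   `E₂ = {C_y ∌ s, x}`
(`FK.coefficient_mono_rc`; equivalently `Cov_{φ(·|C_y∌s,x)}(1{z∈C_y}, ω_e) ≤ 0`, the differential form (L2) of FK-Q2 §11.6), for weights `< 1`
and `y ∉ {s,x,v}`, `x ≠ v`.  Proof = two tree theorems for `φ_{𝐩,q}`: (1) van den Berg–Häggström–Kahn Thm 2.1 (negative correlation of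
`1{z ∈ C_y}` and `1{e ∈ C_{{s,x,v}}} = ω_e` given `y ↮ {s,x,v}`; `BHK2006_twoSetConditionalAssociation_rc_negCorrelation`) and (2) vdBHK Thm 1.3
under the measure conditioned on `e` closed — again an edge-parameter random-cluster measure by Grimmett Thm (3.7)
(`rcMeasureW_real_inter_cylinder`) — giving avoidance monotonicity `φ(z∈C_y | C_y∌s,x,v, e closed) ≤ φ(z∈C_y | C_y∌s,x, e closed)`
(`BHK2006_clusterConditionalPositiveAssociation_rc`).
[cite: VandenbergHaggstromKahn2005, Thm. 2.1 (p. 9), Thm. 1.3 (p. 6)] [cite: Grimmett2006, Thm. (3.7) (p. 39); §1.4 eq. (1.20) (p. 15)]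
-/

noncomputable section

namespace Summit.CriticalPhenomena.PercolationContinuityZ3.Theorems.FK

open MeasureTheory Set
open Literature.Probability.LatticeModels
open Literature.Probability.Percolation Literature.Probability.Percolation.KNPreFKG
open Literature.Probability.Percolation.BHK2006 (openEdgeCluster_mono)
open scoped Classical

variable {V : Type*} [Fintype V]

omit [Fintype V] in
/-- An open pair at `x` belongs to the open edge cluster of any set containing `x`; conversely edge clusters consist of open pairs.
[cite: VandenbergHaggstromKahn2005, §1 p. 3 (definition of C_S)] -/
theorem mem_biUnion_openEdgeCluster_iff {T : Set V} {x v : V} (hxT : x ∈ T) (hxv : x ≠ v) (ω : BondConfig V) :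
    s(x, v) ∈ (⋃ t ∈ T, openEdgeCluster ω t) ↔ s(x, v) ∈ ω := by
  constructor
  · intro h
    obtain ⟨t, -, ht⟩ := Set.mem_iUnion₂.1 h
    exact openEdgeCluster_subset ω t ht
  · intro h
    refine Set.mem_iUnion₂.2 ⟨x, hxT, ?_⟩
    rw [mem_openEdgeCluster_iff]
    refine ⟨h, by rw [Sym2.mk_isDiag_iff]; exact hxv, fun u hu => ?_⟩
    rcases Sym2.mem_iff.1 hu with rfl | rfl
    · exact SimpleGraph.Reachable.refl _
    · exact SimpleGraph.Adj.reachable ((openGraph_adj ω _ _).2 ⟨h, hxv⟩)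

/-- Under weights `< 1` the empty configuration has positive `φ^B_{𝐩,q}`-probability, hence so does every event containing it.
[cite: Grimmett2006, Thm. (3.1) eq. (3.4) (finite energy)] -/
theorem rcMeasureW_real_pos_of_empty_mem (w : Sym2 V → unitInterval) {q : ℝ} (hq : 0 < q) (hw : ∀ e, (w e : ℝ) < 1) (B : Set V)
    {A : Set (BondConfig V)} (hA : (∅ : BondConfig V) ∈ A) : 0 < (rcMeasureW w q B).real A := by
  rw [rcMeasureW_real_eq_sum_div w hq B A]
  refine div_pos ?_ (rcPartitionFunctionW_pos w hq B)
  have hterm : ∀ ω, 0 ≤ rcWeightW w q B ω * DecisionTree.ind A ω := fun ω =>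
    mul_nonneg (rcWeightW_nonneg w hq.le B ω) (DecisionTree.ind_nonneg A ω)
  have hpos : 0 < rcWeightW w q B ∅ * DecisionTree.ind A ∅ := by
    rw [DecisionTree.ind_of_mem hA, mul_one]
    unfold rcWeightW BHK2006.weight
    refine mul_pos (Finset.prod_pos fun e _ => ?_) (pow_pos hq _)
    have h1 : (w e : ℝ) < 1 := hw e
    simp only [Set.mem_empty_iff_false, if_false]
    linarith
  exact lt_of_lt_of_le hpos (Finset.single_le_sum (fun ω _ => hterm ω) (Finset.mem_univ (∅ : BondConfig V)))

/-- **Coefficient monotonicity (hull-port Lemma 2) for `φ_{𝐩,q}`, `q ≥ 1`**: with `E₂ = {C_y ∌ s, x}`, `e = s(x,v)`,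
`φ(E₂ ∩ {z∈C_y} ∩ {e open})·φ(E₂ ∩ {e closed}) ≤ φ(E₂ ∩ {z∈C_y} ∩ {e closed})·φ(E₂ ∩ {e open})` — the conditional probability that the
cluster of `y` reaches `z`, given that it avoids `s` and `x`, is smaller given `e` open than given `e` closed (weights `< 1`, `y ∉ {s,x,v}`, `x ≠ v`).
[cite: VandenbergHaggstromKahn2005, Thm. 2.1 (p. 9), Thm. 1.3 (p. 6)] [cite: Grimmett2006, Thm. (3.7) (p. 39)] -/
theorem coefficient_mono_rc (w : Sym2 V → unitInterval) {q : ℝ} (hq : 1 ≤ q) (hw : ∀ e, (w e : ℝ) < 1)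
    {s x y z v : V} (hys : y ≠ s) (hyx : y ≠ x) (hyv : y ≠ v) (hxv : x ≠ v) :
    (rcMeasureW w q ∅).real ({ω : BondConfig V | ∀ t ∈ ({s, x} : Set V), ¬ (openGraph ω).Reachable y t} ∩ openConn y z ∩
        {ω | s(x, v) ∈ ω}) *
      (rcMeasureW w q ∅).real ({ω : BondConfig V | ∀ t ∈ ({s, x} : Set V), ¬ (openGraph ω).Reachable y t} ∩ {ω | s(x, v) ∈ ω}ᶜ) ≤
    (rcMeasureW w q ∅).real ({ω : BondConfig V | ∀ t ∈ ({s, x} : Set V), ¬ (openGraph ω).Reachable y t} ∩ openConn y z ∩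
        {ω | s(x, v) ∈ ω}ᶜ) *
      (rcMeasureW w q ∅).real ({ω : BondConfig V | ∀ t ∈ ({s, x} : Set V), ¬ (openGraph ω).Reachable y t} ∩ {ω | s(x, v) ∈ ω}) := by
  have hq0 : 0 < q := one_pos.trans_le hq
  haveI := isProbabilityMeasure_rcMeasureW w hq0 (∅ : Set V)
  set φ := rcMeasureW w q ∅ with hφ
  set E2 : Set (BondConfig V) := {ω | ∀ t ∈ ({s, x} : Set V), ¬ (openGraph ω).Reachable y t} with hE2
  set E3 : Set (BondConfig V) := {ω | ∀ s' ∈ ({y} : Set V), ∀ t ∈ ({s, x, v} : Set V), ¬ (openGraph ω).Reachable s' t} with hE3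
  set Zev : Set (BondConfig V) := openConn y z with hZev
  set O : Set (BondConfig V) := {ω | s(x, v) ∈ ω} with hO
  set Vev : Set (BondConfig V) := openConn y v with hVev
  have hmeas : ∀ S : Set (BondConfig V), MeasurableSet S := fun _ => MeasurableSet.of_discrete
  have hn := fun (S : Set (BondConfig V)) => (measureReal_nonneg : 0 ≤ φ.real S)
  -- E3 = E2 ∩ Vevᶜ, and E2 ∩ O ⊆ Vevᶜ
  have hE3eq : E3 = E2 ∩ Vevᶜ := by
    ext ω
    simp only [hE3, hE2, hVev, openConn, mem_setOf_eq, mem_inter_iff, mem_compl_iff, Set.mem_singleton_iff, Set.mem_insert_iff,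
      forall_eq, forall_eq_or_imp]
    tauto
  have hE2O : E2 ∩ O = E3 ∩ O := by
    rw [hE3eq]
    ext ω
    simp only [mem_inter_iff, mem_compl_iff, hVev, openConn, mem_setOf_eq]
    constructor
    · rintro ⟨h2, ho⟩
      refine ⟨⟨h2, fun hyv' => ?_⟩, ho⟩
      have hadj : (openGraph ω).Adj v x := (openGraph_adj ω v x).2 ⟨by rw [Sym2.eq_swap]; exact ho, hxv.symm⟩
      exact h2 x (by simp) (hyv'.trans hadj.reachable)
    · rintro ⟨⟨h2, -⟩, ho⟩; exact ⟨h2, ho⟩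
  -- (1) vdBHK Thm 2.1: `1{z∈C_y}` and `ω_e = 1{e ∈ C_{{s,x,v}}}` are negatively correlated given `E3`
  have hF : ∀ ω : BondConfig V, (connFamily y z).indicator (1 : Set (Sym2 V) → ℝ) (⋃ s' ∈ ({y} : Set V), openEdgeCluster ω s') =
      Zev.indicator (1 : BondConfig V → ℝ) ω := fun ω => by
    rw [biUnion_singleton, congrFun (indicator_comp_openEdgeCluster (connFamily y z) y) ω, ← openConn_eq_setOf_connFamily]
  have hGmono : Monotone (fun C : Set (Sym2 V) => ({C : Set (Sym2 V) | s(x, v) ∈ C} : Set (Set (Sym2 V))).indicator (1 : Set (Sym2 V) → ℝ) C) :=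
    monotone_indicator_one_of_isUpperSet (fun C C' h hC => h hC)
  have hG : ∀ ω : BondConfig V, ({C : Set (Sym2 V) | s(x, v) ∈ C} : Set (Set (Sym2 V))).indicator (1 : Set (Sym2 V) → ℝ)
      (⋃ t ∈ ({s, x, v} : Set V), openEdgeCluster ω t) = O.indicator (1 : BondConfig V → ℝ) ω := by
    intro ω
    have hiff := mem_biUnion_openEdgeCluster_iff (T := ({s, x, v} : Set V)) (by simp) hxv ω
    by_cases ho : s(x, v) ∈ ω
    · rw [Set.indicator_of_mem (show (⋃ t ∈ ({s, x, v} : Set V), openEdgeCluster ω t) ∈ {C : Set (Sym2 V) | s(x, v) ∈ C} from hiff.2 ho),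
        Set.indicator_of_mem (show ω ∈ O from ho)]
      rfl
    · rw [Set.indicator_of_notMem (show (⋃ t ∈ ({s, x, v} : Set V), openEdgeCluster ω t) ∉ {C : Set (Sym2 V) | s(x, v) ∈ C} from
          fun h => ho (hiff.1 h)), Set.indicator_of_notMem (show ω ∉ O from ho)]
  have hBHK := BHK2006_twoSetConditionalAssociation_rc_negCorrelation w hq ({y} : Set V) ({s, x, v} : Set V)
    ((connFamily y z).indicator 1) (fun C => ({C : Set (Sym2 V) | s(x, v) ∈ C} : Set (Set (Sym2 V))).indicator 1 C)
    (monotone_indicator_one_of_isUpperSet (isUpperSet_connFamily y z)) hGmono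
  simp only [hF, hG] at hBHK
  rw [← hE3] at hBHK
  have hprod2 : (fun ω : BondConfig V => Zev.indicator (1 : BondConfig V → ℝ) ω * O.indicator (1 : BondConfig V → ℝ) ω) =
      (Zev ∩ O).indicator 1 := indicator_one_mul_indicator_one Zev O
  rw [show (fun ω : BondConfig V => Zev.indicator (1 : BondConfig V → ℝ) ω * O.indicator (1 : BondConfig V → ℝ) ω) =
      (Zev ∩ O).indicator 1 from hprod2] at hBHK
  rw [setIntegral_indicator_one_eq, setIntegral_indicator_one_eq, setIntegral_indicator_one_eq] at hBHK
  -- hBHK : φ(E3) * φ(E3 ∩ (Zev ∩ O)) ≤ φ(E3 ∩ Zev) * φ(E3 ∩ O)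
  -- (2) under `e` closed: avoidance monotonicity for `C_y` by vdBHK 1.3 for the pinned measure
  set w0 : Sym2 V → unitInterval := condWeights w ({s(x, v)} : Set (Sym2 V))ᶜ ∅ with hw0
  have hOc : {ω : BondConfig V | ω \ ({s(x, v)} : Set (Sym2 V))ᶜ = ∅} = Oᶜ := by
    ext ω
    simp only [mem_setOf_eq, Set.sdiff_compl, mem_compl_iff, hO, Set.inter_singleton_eq_empty]
  have hcyl : ∀ A : Set (BondConfig V), φ.real (A ∩ Oᶜ) = φ.real Oᶜ * (rcMeasureW w0 q ∅).real A := by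
    intro A
    have := rcMeasureW_real_inter_cylinder w hq0 (∅ : Set V) (F := ({s(x, v)} : Set (Sym2 V))ᶜ) (ξ := ∅)
      (Set.empty_disjoint _) A
    rw [hOc] at this
    exact this
  have hCPA := BHK2006_clusterConditionalPositiveAssociation_rc w0 hq y ({s, x} : Set V)
    ((connFamily y z).indicator 1) ((connFamily y v).indicator 1)
    (monotone_indicator_one_of_isUpperSet (isUpperSet_connFamily y z)) (monotone_indicator_one_of_isUpperSet (isUpperSet_connFamily y v))
  have hFz : ∀ ω : BondConfig V, (connFamily y z).indicator (1 : Set (Sym2 V) → ℝ) (openEdgeCluster ω y) =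
      Zev.indicator (1 : BondConfig V → ℝ) ω := fun ω => by
    rw [congrFun (indicator_comp_openEdgeCluster (connFamily y z) y) ω, ← openConn_eq_setOf_connFamily]
  have hFv : ∀ ω : BondConfig V, (connFamily y v).indicator (1 : Set (Sym2 V) → ℝ) (openEdgeCluster ω y) =
      Vev.indicator (1 : BondConfig V → ℝ) ω := fun ω => by
    rw [congrFun (indicator_comp_openEdgeCluster (connFamily y v) y) ω, ← openConn_eq_setOf_connFamily]
  simp only [hFz, hFv] at hCPA
  rw [← hE2, show (fun ω : BondConfig V => Zev.indicator (1 : BondConfig V → ℝ) ω * Vev.indicator (1 : BondConfig V → ℝ) ω) =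
      (Zev ∩ Vev).indicator 1 from indicator_one_mul_indicator_one Zev Vev] at hCPA
  haveI := isProbabilityMeasure_rcMeasureW w0 hq0 (∅ : Set V)
  rw [setIntegral_indicator_one_eq, setIntegral_indicator_one_eq, setIntegral_indicator_one_eq] at hCPA
  -- hCPA : φ₀(E2 ∩ Zev) * φ₀(E2 ∩ Vev) ≤ φ₀(E2) * φ₀(E2 ∩ (Zev ∩ Vev))
  -- translate φ₀ into φ(· ∩ Oᶜ)
  have hOcn := hn Oᶜ
  have hCPA' : φ.real ((E2 ∩ Zev) ∩ Oᶜ) * φ.real ((E2 ∩ Vev) ∩ Oᶜ) ≤ φ.real (E2 ∩ Oᶜ) * φ.real ((E2 ∩ (Zev ∩ Vev)) ∩ Oᶜ) := by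
    rw [hcyl, hcyl, hcyl, hcyl]
    have := mul_le_mul_of_nonneg_left hCPA (mul_nonneg hOcn hOcn)
    calc φ.real Oᶜ * (rcMeasureW w0 q ∅).real (E2 ∩ Zev) * (φ.real Oᶜ * (rcMeasureW w0 q ∅).real (E2 ∩ Vev))
        = φ.real Oᶜ * φ.real Oᶜ * ((rcMeasureW w0 q ∅).real (E2 ∩ Zev) * (rcMeasureW w0 q ∅).real (E2 ∩ Vev)) := by ring
      _ ≤ φ.real Oᶜ * φ.real Oᶜ * ((rcMeasureW w0 q ∅).real E2 * (rcMeasureW w0 q ∅).real (E2 ∩ (Zev ∩ Vev))) := this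
      _ = _ := by ring
  -- the masses restricted to `e` closed / open
  have hsplitV : ∀ A : Set (BondConfig V), φ.real (A ∩ Oᶜ) = φ.real (A ∩ Vev ∩ Oᶜ) + φ.real (A ∩ Vevᶜ ∩ Oᶜ) := by
    intro A
    have := measureReal_inter_add_sdiff (μ := φ) (s := A ∩ Oᶜ) (h := measure_ne_top _ _) (hmeas Vev)
    rw [← this, Set.sdiff_eq]
    congr 1
    · rw [Set.inter_right_comm]
    · rw [Set.inter_right_comm]
  -- names for the eight masses
  have e3z : E3 ∩ Zev = E2 ∩ Zev ∩ Vevᶜ := by rw [hE3eq]; ac_rfl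
  have hA1 : E2 ∩ Zev ∩ O = E3 ∩ (Zev ∩ O) := by
    rw [Set.inter_right_comm, hE2O, Set.inter_right_comm, Set.inter_assoc]
  -- (ii): φ(E3 ∩ Oᶜ)·a₁ ≤ φ(E3 ∩ Zev ∩ Oᶜ)·b₁
  have hE3split : φ.real E3 = φ.real (E3 ∩ O) + φ.real (E3 ∩ Oᶜ) := by
    rw [← measureReal_inter_add_sdiff (μ := φ) (s := E3) (h := measure_ne_top _ _) (hmeas O), Set.sdiff_eq]
  have hE3Zsplit : φ.real (E3 ∩ Zev) = φ.real (E3 ∩ (Zev ∩ O)) + φ.real (E3 ∩ Zev ∩ Oᶜ) := by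
    rw [← measureReal_inter_add_sdiff (μ := φ) (s := E3 ∩ Zev) (h := measure_ne_top _ _) (hmeas O), Set.sdiff_eq, Set.inter_assoc]
  have hii : φ.real (E3 ∩ Oᶜ) * φ.real (E3 ∩ (Zev ∩ O)) ≤ φ.real (E3 ∩ Zev ∩ Oᶜ) * φ.real (E3 ∩ O) := by
    rw [hE3split, hE3Zsplit] at hBHK
    nlinarith [hBHK, hn (E3 ∩ O), hn (E3 ∩ (Zev ∩ O))]
  -- (iii)': φ(E3 ∩ Zev ∩ Oᶜ)·φ(E2 ∩ Oᶜ) ≤ φ(E2 ∩ Zev ∩ Oᶜ)·φ(E3 ∩ Oᶜ)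
  have hiii : φ.real (E3 ∩ Zev ∩ Oᶜ) * φ.real (E2 ∩ Oᶜ) ≤ φ.real (E2 ∩ Zev ∩ Oᶜ) * φ.real (E3 ∩ Oᶜ) := by
    have h1 := hsplitV E2
    have h2 := hsplitV (E2 ∩ Zev)
    have hE3O : E3 ∩ Oᶜ = E2 ∩ Vevᶜ ∩ Oᶜ := by rw [hE3eq]
    have hE3ZO : E3 ∩ Zev ∩ Oᶜ = E2 ∩ Zev ∩ Vevᶜ ∩ Oᶜ := by rw [e3z]
    rw [hE3O, hE3ZO]
    have hc : φ.real ((E2 ∩ (Zev ∩ Vev)) ∩ Oᶜ) = φ.real (E2 ∩ Zev ∩ Vev ∩ Oᶜ) := by rw [Set.inter_assoc E2 Zev Vev]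
    rw [hc] at hCPA'
    rw [show (E2 ∩ Zev) ∩ Oᶜ = E2 ∩ Zev ∩ Oᶜ from rfl] at hCPA'
    nlinarith [hCPA', h1, h2, hn (E2 ∩ Zev ∩ Vev ∩ Oᶜ), hn (E2 ∩ Vev ∩ Oᶜ), hn (E2 ∩ Zev ∩ Vevᶜ ∩ Oᶜ), hn (E2 ∩ Vevᶜ ∩ Oᶜ)]
  -- positivity of φ(E3 ∩ Oᶜ): the empty configuration lies in it
  have hc0 : 0 < φ.real (E3 ∩ Oᶜ) := by
    refine rcMeasureW_real_pos_of_empty_mem w hq0 hw ∅ ⟨?_, ?_⟩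
    · show (∅ : BondConfig V) ∈ E3
      simp only [hE3, mem_setOf_eq]
      intro s' hs' t ht h
      rw [Set.mem_singleton_iff] at hs'
      subst hs'
      have hbot : openGraph (∅ : BondConfig V) = ⊥ := SimpleGraph.fromEdgeSet_empty
      rw [hbot, SimpleGraph.reachable_bot] at h
      subst h
      simp only [Set.mem_insert_iff, Set.mem_singleton_iff] at ht
      rcases ht with h1 | h1 | h1
      · exact hys h1
      · exact hyx h1
      · exact hyv h1
    · show (∅ : BondConfig V) ∈ Oᶜ
      simp [hO]
  -- assemble: c₀·(a₁ b₀) ≤ c₀·(a₀ b₁)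
  rw [hA1]
  have hb0 := hn (E2 ∩ Oᶜ)
  have hb1 := hn (E3 ∩ O)
  have key : φ.real (E3 ∩ Oᶜ) * (φ.real (E3 ∩ (Zev ∩ O)) * φ.real (E2 ∩ Oᶜ)) ≤
      φ.real (E3 ∩ Oᶜ) * (φ.real (E2 ∩ Zev ∩ Oᶜ) * φ.real (E3 ∩ O)) := by
    have h1 := mul_le_mul_of_nonneg_right hii hb0
    have h2 := mul_le_mul_of_nonneg_right hiii hb1
    nlinarith [h1, h2]
  rw [hE2O]
  exact le_of_mul_le_mul_left key hc0

end Summit.CriticalPhenomena.PercolationContinuityZ3.Theorems.FK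

end
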